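import Literature.NumberTheory.LFunctions.SelbergClassDirichletProofs
import Literature.NumberTheory.LFunctions.ConreyIwaniec2002AFELineIntegrals
import Literature.Analysis.SpecialFunctions.GammaVerticalBounds
import HarnessLib

/-!
# The smooth approximate functional equation for primitive Dirichlet `L`-functions, I:
# the contour identity `2π Λ̃(χ,s) = I(χ,s) + ε(χ) I(χ̄, 1−s)`

Topic `Literature/NumberTheory/LFunctions`. Everything here is PROVED (no definitions, no named facts).

Let `χ` be a primitive Dirichlet character modulo `q > 1`, `Λ(χ,s)` Mathlib's completed
`L`-function (`completedLFunction χ s = γ(s) L(s,χ)`, `γ = gammaFactor χ = Γ_ℝ(s + κ)`,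
`κ ∈ {0,1}`), `ε(χ)` the root number (`rootNumber χ`, `|ε(χ)| = 1`), and put
`Λ̃(χ,s) = q^{s/2} Λ(χ,s)`, so that the functional equation reads `Λ̃(χ, 1−s) = ε(χ) Λ̃(χ̄, s)`
(`IsPrimitive.completedLFunction_one_sub`). With the test function `G(u) = e^{u²}` and the
line `u = 3/4 + iv` put

  `I(χ, s) = ∫ Λ̃(χ, s+u) G(u) u^{-1} dv`.

For `Re s = ½` we prove the contour identity of the approximate functional equation
([IwaniecKowalski2004, Theorem 5.3, proof]: integrate `Λ̃(χ,s+u)G(u)/u` over `Re u = ±3/4`, the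
pole at `u = 0` has residue `Λ̃(χ,s)`, and on `Re u = −3/4` apply the functional equation and
`u ↦ −u`):

* `norm_LambdaTilde_le` — `‖Λ̃(χ,z)‖ ≤ 8 q² Z (1 + |Im z|)` on `−1/4 ≤ Re z ≤ 5/4`
  (`Z = Σ n^{-3/2}`; from `Λ = γ L`, `|Γ_ℝ| ≤ 4` there, the tree's
  `SelbergDirichlet.norm_LFunction_le_of_half_le_re`, and the functional equation on `Re z < ½`);
* `LambdaTilde_reflect` — `Λ̃(χ, s − u) = ε(χ) Λ̃(χ̄, (1−s) + u)`;
* `afe_contour_identity` — **`2π Λ̃(χ,s) = I(χ,s) + ε(χ) I(χ̄, 1−s)`** for `Re s = ½`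
  (the shift by the tree's `ConreyIwaniec2002.AFEKernel.integral_lineF_one_sub_eq` with `y = 1`).

## References
* [IwaniecKowalski2004] H. Iwaniec, E. Kowalski, *Analytic Number Theory*, AMS Coll. Publ. 53
  (2004), §5.2, Theorem 5.3 (proof).
-/

noncomputable section

open Complex MeasureTheory Real Set Filter DirichletCharacter
open scoped Topology

namespace Literature.NumberTheory.LFunctions.DirichletConvexity

open Literature.NumberTheory.LFunctions.SelbergDirichlet (gammaFactor_inv gammaFactor_ne_zero_of_re_pos
  isPrimitive_inv ne_one_of_isPrimitive gammaFactor_shape norm_LFunction_le_of_half_le_re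
  tsum_rpow_nonneg norm_rootNumber)
open Literature.NumberTheory.LFunctions.ConreyIwaniec2002.AFEKernel (integral_lineF_one_sub_eq
  integrable_lineF norm_integral_lineF_le)

variable {q : ℕ} [NeZero q]

/-! ### §1. The gamma factor and `Λ = γ L` on `Re z ≥ 1/2` -/

omit [NeZero q] in
/-- `Γ(x) ≤ 4` for `1/4 ≤ x ≤ 9/8` (convexity; `Γ(1/4) = 4Γ(5/4) ≤ 4`, `Γ(9/8) ≤ 1`). [folklore] -/
private theorem Real_Gamma_le_four {x : ℝ} (h1 : 1 / 4 ≤ x) (h2 : x ≤ 9 / 8) : Real.Gamma x ≤ 4 := by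
  have hconv := Real.convexOn_Gamma
  have hle1 : ∀ y : ℝ, 1 ≤ y → y ≤ 2 → Real.Gamma y ≤ 1 := by
    intro y hy1 hy2
    have h := ConvexOn.le_max_of_mem_Icc hconv (show (1 : ℝ) ∈ Ioi 0 by norm_num)
      (show (2 : ℝ) ∈ Ioi 0 by norm_num) (show y ∈ Icc (1 : ℝ) 2 from ⟨hy1, hy2⟩)
    rwa [Real.Gamma_one, Real.Gamma_two, max_self] at h
  have h14 : Real.Gamma (1 / 4) ≤ 4 := by
    have hrec : Real.Gamma (1 / 4 + 1) = 1 / 4 * Real.Gamma (1 / 4) := Real.Gamma_add_one (by norm_num)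
    have h54 : Real.Gamma (1 / 4 + 1) ≤ 1 := hle1 _ (by norm_num) (by norm_num)
    linarith
  have h98 : Real.Gamma (9 / 8) ≤ 1 := hle1 _ (by norm_num) (by norm_num)
  have h := ConvexOn.le_max_of_mem_Icc hconv (show (1 / 4 : ℝ) ∈ Ioi 0 by norm_num)
    (show (9 / 8 : ℝ) ∈ Ioi 0 by norm_num) ⟨h1, h2⟩
  exact h.trans (max_le h14 (by linarith))

omit [NeZero q] in
/-- `‖Γ_ℝ(w)‖ ≤ 4` for `1/2 ≤ Re w ≤ 9/4` (`|π^{-w/2}| ≤ 1`, `|Γ(w/2)| ≤ Γ(Re w/2) ≤ 4`). [folklore] -/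
private theorem norm_Gammaℝ_le_four {w : ℂ} (h1 : 1 / 2 ≤ w.re) (h2 : w.re ≤ 9 / 4) :
    ‖Gammaℝ w‖ ≤ 4 := by
  rw [Gammaℝ_def, norm_mul]
  have hπ : ‖(π : ℂ) ^ (-w / 2)‖ ≤ 1 := by
    rw [Complex.norm_cpow_eq_rpow_re_of_pos Real.pi_pos]
    have hre : (-w / 2).re = -(w.re / 2) := by simp; ring
    rw [hre]
    exact Real.rpow_le_one_of_one_le_of_nonpos (by have := Real.pi_gt_three; linarith) (by linarith)
  have hΓ : ‖Complex.Gamma (w / 2)‖ ≤ 4 := by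
    have e : w / 2 = ((w.re / 2 : ℝ) : ℂ) + ((w.im / 2 : ℝ) : ℂ) * I := by
      apply Complex.ext <;> simp
    rw [e]
    refine (Literature.Analysis.SpecialFunctions.GammaVert.norm_Gamma_le_Gamma_re
      (by linarith) _).trans ?_
    exact Real_Gamma_le_four (by linarith) (by linarith)
  calc ‖(π : ℂ) ^ (-w / 2)‖ * ‖Complex.Gamma (w / 2)‖ ≤ 1 * 4 :=
        mul_le_mul hπ hΓ (norm_nonneg _) (by norm_num)
    _ = 4 := by ring

omit [NeZero q] in
/-- `‖γ_ψ(z)‖ ≤ 4` for `1/2 ≤ Re z ≤ 5/4` (any Dirichlet character `ψ`). [folklore] -/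
private theorem norm_gammaFactor_le_four (ψ : DirichletCharacter ℂ q) {z : ℂ} (h1 : 1 / 2 ≤ z.re)
    (h2 : z.re ≤ 5 / 4) : ‖gammaFactor ψ z‖ ≤ 4 := by
  obtain ⟨κ, hκ, hγ⟩ := gammaFactor_shape ψ
  rw [hγ z]
  have hκ' : (κ : ℝ) ≤ 1 := by exact_mod_cast hκ
  have hκ0 : (0 : ℝ) ≤ κ := Nat.cast_nonneg κ
  exact norm_Gammaℝ_le_four (by simp; linarith) (by simp; linarith)

/-- `Λ(ψ,z) = γ_ψ(z) L(z,ψ)` where the gamma factor is finite and non-zero (`Re z > 0`,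
`q ≠ 1`). [folklore] -/
private theorem completedLFunction_eq_mul (hq : q ≠ 1) (ψ : DirichletCharacter ℂ q) {z : ℂ}
    (hz : 0 < z.re) : completedLFunction ψ z = gammaFactor ψ z * LFunction ψ z := by
  rw [LFunction_eq_completed_div_gammaFactor ψ z (Or.inr hq)]
  field_simp [gammaFactor_ne_zero_of_re_pos ψ hz]

/-- **`Λ(ψ, z)` on `1/2 ≤ Re z ≤ 5/4`**: `‖Λ(ψ,z)‖ ≤ 4 q Z ‖z‖` for `ψ ≠ 1` mod `q ≠ 1`,
`Z = Σ_{n≥1} n^{-3/2}`. [cite: IwaniecKowalski2004, Theorem 5.3 (proof)] -/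
theorem norm_completedLFunction_le (hq : q ≠ 1) {ψ : DirichletCharacter ℂ q} (hψ : ψ ≠ 1)
    {z : ℂ} (h1 : 1 / 2 ≤ z.re) (h2 : z.re ≤ 5 / 4) :
    ‖completedLFunction ψ z‖ ≤
      4 * (q * (∑' n : ℕ, ((n + 1 : ℕ) : ℝ) ^ (-(1 / 2 : ℝ) - 1)) * ‖z‖) := by
  rw [completedLFunction_eq_mul hq ψ (by linarith), norm_mul]
  exact mul_le_mul (norm_gammaFactor_le_four ψ h1 h2) (norm_LFunction_le_of_half_le_re hψ h1)
    (norm_nonneg _) (by norm_num)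

/-! ### §2. `Λ̃(χ,z) = q^{z/2} Λ(χ,z)`: reflection and the strip bound -/

/-- **The functional equation for `Λ̃`**: `Λ̃(χ, s − u) = ε(χ) Λ̃(χ̄, (1 − s) + u)`, i.e.
`q^{(s−u)/2} Λ(χ, s−u) = ε(χ) q^{(1−s+u)/2} Λ(χ⁻¹, 1−s+u)` (`χ` primitive).
[cite: IwaniecKowalski2004, Theorem 5.3 (proof)] -/
theorem LambdaTilde_reflect {χ : DirichletCharacter ℂ q} (hχ : χ.IsPrimitive) (s u : ℂ) :
    (q : ℂ) ^ ((s - u) / 2) * completedLFunction χ (s - u) =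
      rootNumber χ * ((q : ℂ) ^ ((1 - s + u) / 2) * completedLFunction χ⁻¹ (1 - s + u)) := by
  have hq0 : (q : ℂ) ≠ 0 := by exact_mod_cast NeZero.ne q
  have hfe := hχ.completedLFunction_one_sub (1 - s + u)
  rw [show (1 : ℂ) - (1 - s + u) = s - u by ring] at hfe
  rw [hfe]
  have e : (q : ℂ) ^ ((s - u) / 2) * (q : ℂ) ^ (1 - s + u - 1 / 2) = (q : ℂ) ^ ((1 - s + u) / 2) := by
    rw [← Complex.cpow_add _ _ hq0]; congr 1; ring
  calc (q : ℂ) ^ ((s - u) / 2) * ((q : ℂ) ^ (1 - s + u - 1 / 2) * rootNumber χ *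
        completedLFunction χ⁻¹ (1 - s + u))
      = rootNumber χ * (((q : ℂ) ^ ((s - u) / 2) * (q : ℂ) ^ (1 - s + u - 1 / 2)) *
          completedLFunction χ⁻¹ (1 - s + u)) := by ring
    _ = _ := by rw [e]

/-- **`Λ̃` in the strip**: for `χ` primitive mod `q > 1` and `−1/4 ≤ Re z ≤ 5/4`,
`‖q^{z/2} Λ(χ,z)‖ ≤ 8 q² Z (1 + |Im z|)` (`Λ = γL` with `|γ| ≤ 4`, `|L| ≤ qZ|z|` on `Re z ≥ ½`;
the functional equation and `|ε(χ)| = 1` on `Re z < ½`). [cite: IwaniecKowalski2004, Theorem 5.3 (proof)] -/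
theorem norm_LambdaTilde_le (hq : 1 < q) {χ : DirichletCharacter ℂ q} (hχ : χ.IsPrimitive) {z : ℂ}
    (h1 : -(1 / 4) ≤ z.re) (h2 : z.re ≤ 5 / 4) :
    ‖(q : ℂ) ^ (z / 2) * completedLFunction χ z‖ ≤
      8 * (q : ℝ) ^ 2 * (∑' n : ℕ, ((n + 1 : ℕ) : ℝ) ^ (-(1 / 2 : ℝ) - 1)) * (1 + |z.im|) := by
  have hq1 : q ≠ 1 := by omega
  have hqpos : 0 < q := by omega
  have hqR : (1 : ℝ) ≤ q := by exact_mod_cast hq.le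
  set Z : ℝ := ∑' n : ℕ, ((n + 1 : ℕ) : ℝ) ^ (-(1 / 2 : ℝ) - 1) with hZ
  have hZ0 : 0 ≤ Z := tsum_rpow_nonneg
  have hχ1 : χ ≠ 1 := ne_one_of_isPrimitive hq1 hχ
  have hχ1' : χ⁻¹ ≠ 1 := by
    intro h; apply hχ1; rw [← inv_inv χ, h, inv_one]
  have hy0 := abs_nonneg z.im
  -- `‖q^{w}‖ ≤ q` for `0 ≤ Re w ≤ 1`
  have hqpow : ∀ w : ℂ, 0 ≤ w.re → w.re ≤ 1 → ‖(q : ℂ) ^ w‖ ≤ q := by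
    intro w hw0 hw1
    rw [Complex.norm_natCast_cpow_of_pos hqpos]
    calc (q : ℝ) ^ w.re ≤ (q : ℝ) ^ (1 : ℝ) := Real.rpow_le_rpow_of_exponent_le hqR hw1
      _ = q := Real.rpow_one _
  rcases le_or_gt (1 / 2) z.re with hz | hz
  · -- `Re z ≥ 1/2`
    have hΛ := norm_completedLFunction_le hq1 hχ1 hz h2
    have hzn : ‖z‖ ≤ 2 * (1 + |z.im|) := by
      have := Complex.norm_le_abs_re_add_abs_im z
      have : |z.re| ≤ 5 / 4 := abs_le.2 ⟨by linarith, h2⟩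
      linarith
    have hq' := hqpow (z / 2) (by simp; linarith) (by simp; linarith)
    rw [norm_mul]
    calc ‖(q : ℂ) ^ (z / 2)‖ * ‖completedLFunction χ z‖ ≤ q * (4 * (q * Z * ‖z‖)) :=
          mul_le_mul hq' hΛ (norm_nonneg _) (by positivity)
      _ ≤ q * (4 * (q * Z * (2 * (1 + |z.im|)))) := by gcongr
      _ = 8 * (q : ℝ) ^ 2 * Z * (1 + |z.im|) := by ring
  · -- `Re z < 1/2`: reflect
    have hrefl := LambdaTilde_reflect hχ z 0
    simp only [sub_zero, add_zero] at hrefl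
    rw [hrefl, norm_mul, norm_rootNumber hχ, one_mul, norm_mul]
    have hz' : 1 / 2 ≤ (1 - z : ℂ).re := by simp; linarith
    have hz'' : (1 - z : ℂ).re ≤ 5 / 4 := by simp; linarith
    have hΛ := norm_completedLFunction_le hq1 hχ1' hz' hz''
    have hzn : ‖(1 : ℂ) - z‖ ≤ 2 * (1 + |z.im|) := by
      have h := Complex.norm_le_abs_re_add_abs_im (1 - z)
      have hre : |(1 - z : ℂ).re| ≤ 5 / 4 := by
        rw [sub_re, one_re]; exact abs_le.2 ⟨by linarith, by linarith⟩
      have him : |(1 - z : ℂ).im| = |z.im| := by rw [sub_im, one_im, zero_sub, abs_neg]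
      linarith
    have hq' := hqpow ((1 - z) / 2) (by simp; linarith) (by simp; linarith)
    calc ‖(q : ℂ) ^ ((1 - z) / 2)‖ * ‖completedLFunction χ⁻¹ (1 - z)‖ ≤ q * (4 * (q * Z * ‖(1 : ℂ) - z‖)) :=
          mul_le_mul hq' hΛ (norm_nonneg _) (by positivity)
      _ ≤ q * (4 * (q * Z * (2 * (1 + |z.im|)))) := by gcongr
      _ = 8 * (q : ℝ) ^ 2 * Z * (1 + |z.im|) := by ring

/-- `Λ̃(χ, ·)` is entire (`χ ≠ 1`). [folklore] -/
private theorem differentiable_LambdaTilde {χ : DirichletCharacter ℂ q} (hχ1 : χ ≠ 1) :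
    Differentiable ℂ fun z : ℂ => (q : ℂ) ^ (z / 2) * completedLFunction χ z := by
  have hq0 : (q : ℂ) ≠ 0 := by exact_mod_cast NeZero.ne q
  exact ((differentiable_id.div_const 2).const_cpow (Or.inl hq0)).mul
    (differentiable_completedLFunction hχ1)

/-- **Stirling class of `u ↦ Λ̃(χ, s+u)` on `−3/4 ≤ Re u ≤ 3/4`** (`Re s = ½`): the bound
`M (1+|Im u|) e^{π|Im u|/2}` with `M = 8q²Z(1+|Im s|)`, as required by the Gaussian line-integral
machinery `ConreyIwaniec2002.AFEKernel`. [cite: IwaniecKowalski2004, Theorem 5.3 (proof)] -/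
theorem norm_LambdaTilde_shift_le (hq : 1 < q) {χ : DirichletCharacter ℂ q} (hχ : χ.IsPrimitive)
    {s : ℂ} (hs : s.re = 1 / 2) (u : ℂ) (hu1 : -(3 / 4) ≤ u.re) (hu2 : u.re ≤ 3 / 4) :
    ‖(fun w : ℂ => (q : ℂ) ^ ((s + w) / 2) * completedLFunction χ (s + w)) u‖ ≤
      8 * (q : ℝ) ^ 2 * (∑' n : ℕ, ((n + 1 : ℕ) : ℝ) ^ (-(1 / 2 : ℝ) - 1)) * (1 + |s.im|) *
        (1 + |u.im|) ^ 1 * Real.exp (π * |u.im| / 2) := by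
  have h := norm_LambdaTilde_le hq hχ (z := s + u) (by simp; linarith) (by simp; linarith)
  simp only
  refine h.trans ?_
  set A : ℝ := 8 * (q : ℝ) ^ 2 * (∑' n : ℕ, ((n + 1 : ℕ) : ℝ) ^ (-(1 / 2 : ℝ) - 1)) with hA
  have hA0 : 0 ≤ A := by rw [hA]; have := tsum_rpow_nonneg; positivity
  have him : |(s + u).im| ≤ |s.im| + |u.im| := by rw [add_im]; exact abs_add_le _ _
  have hE : 1 ≤ Real.exp (π * |u.im| / 2) := Real.one_le_exp (by positivity)
  have h1 : 1 + |(s + u).im| ≤ (1 + |s.im|) * (1 + |u.im|) ^ 1 * 1 := by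
    rw [pow_one, mul_one]; nlinarith [abs_nonneg s.im, abs_nonneg u.im]
  calc A * (1 + |(s + u).im|) ≤ A * ((1 + |s.im|) * (1 + |u.im|) ^ 1 * 1) :=
        mul_le_mul_of_nonneg_left h1 hA0
    _ ≤ A * ((1 + |s.im|) * (1 + |u.im|) ^ 1 * Real.exp (π * |u.im| / 2)) := by gcongr
    _ = _ := by ring

/-! ### §3. The contour identity -/

/-- **The shift across `u = 0`**: with `h(u) = Λ̃(χ, s+u)`, `Re s = ½`,
`∫ h(¾+iv) e^{(¾+iv)²}/(¾+iv) dv − ∫ h(−¾+iv) e^{(−¾+iv)²}/(−¾+iv) dv = 2π Λ̃(χ,s)`.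
[cite: IwaniecKowalski2004, Theorem 5.3 (proof)] -/
theorem integral_LambdaTilde_shift (hq : 1 < q) {χ : DirichletCharacter ℂ q} (hχ : χ.IsPrimitive)
    {s : ℂ} (hs : s.re = 1 / 2) :
    (∫ v : ℝ, (fun w : ℂ => (q : ℂ) ^ ((s + w) / 2) * completedLFunction χ (s + w))
        (((3 / 4 : ℝ) : ℂ) + v * I) * cexp ((((3 / 4 : ℝ) : ℂ) + v * I) ^ 2) *
        (((1 : ℝ) : ℂ)) ^ (-(((3 / 4 : ℝ) : ℂ) + v * I)) / (((3 / 4 : ℝ) : ℂ) + v * I)) -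
    (∫ v : ℝ, (fun w : ℂ => (q : ℂ) ^ ((s + w) / 2) * completedLFunction χ (s + w))
        (((-(3 / 4) : ℝ) : ℂ) + v * I) * cexp ((((-(3 / 4) : ℝ) : ℂ) + v * I) ^ 2) *
        (((1 : ℝ) : ℂ)) ^ (-(((-(3 / 4) : ℝ) : ℂ) + v * I)) / (((-(3 / 4) : ℝ) : ℂ) + v * I)) =
      2 * π * ((q : ℂ) ^ (s / 2) * completedLFunction χ s) := by
  have hq1 : q ≠ 1 := by omega
  have hχ1 : χ ≠ 1 := ne_one_of_isPrimitive hq1 hχ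
  have hd : DifferentiableOn ℂ (fun w : ℂ => (q : ℂ) ^ ((s + w) / 2) * completedLFunction χ (s + w))
      (re ⁻¹' Icc (-(3 / 4)) (3 / 4)) :=
    ((differentiable_LambdaTilde hχ1).comp ((differentiable_const s).add differentiable_id)).differentiableOn
  have h := integral_lineF_one_sub_eq (h := fun w : ℂ => (q : ℂ) ^ ((s + w) / 2) *
      completedLFunction χ (s + w)) (a := -(3 / 4)) (b := 3 / 4) (y := 1) (n := 1)
    (M := 8 * (q : ℝ) ^ 2 * (∑' n : ℕ, ((n + 1 : ℕ) : ℝ) ^ (-(1 / 2 : ℝ) - 1)) * (1 + |s.im|))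
    (by norm_num) (by norm_num) one_pos hd
    (fun u hu1 hu2 => norm_LambdaTilde_shift_le hq hχ hs u hu1 hu2)
  simpa using h

omit [NeZero q] in
/-- Reflection of a whole-line integral: `∫ f(−v) dv = ∫ f(v) dv`. [folklore] -/
private theorem integral_comp_neg' (f : ℝ → ℂ) : ∫ v : ℝ, f (-v) = ∫ v : ℝ, f v := by
  have h := Measure.integral_comp_mul_left f (-1)
  simp only [neg_mul, one_mul, inv_neg, inv_one, abs_neg, abs_one, one_smul] at h
  exact h

/-- **The reflected line**: with `h_χ(u) = Λ̃(χ, s+u)` and `h'(u) = Λ̃(χ̄, (1−s)+u)`,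
`∫ h_χ(−¾+iv) e^{(−¾+iv)²}/(−¾+iv) dv = −ε(χ) ∫ h'(¾+iv) e^{(¾+iv)²}/(¾+iv) dv`
(`v ↦ −v`, then `Λ̃(χ, s−u) = ε(χ)Λ̃(χ̄, 1−s+u)` and `G(−u) = G(u)`).
[cite: IwaniecKowalski2004, Theorem 5.3 (proof)] -/
theorem integral_LambdaTilde_left_eq {χ : DirichletCharacter ℂ q} (hχ : χ.IsPrimitive) (s : ℂ) :
    (∫ v : ℝ, (fun w : ℂ => (q : ℂ) ^ ((s + w) / 2) * completedLFunction χ (s + w))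
        (((-(3 / 4) : ℝ) : ℂ) + v * I) * cexp ((((-(3 / 4) : ℝ) : ℂ) + v * I) ^ 2) *
        (((1 : ℝ) : ℂ)) ^ (-(((-(3 / 4) : ℝ) : ℂ) + v * I)) / (((-(3 / 4) : ℝ) : ℂ) + v * I)) =
    -rootNumber χ * ∫ v : ℝ, (fun w : ℂ => (q : ℂ) ^ ((1 - s + w) / 2) *
        completedLFunction χ⁻¹ (1 - s + w))
        (((3 / 4 : ℝ) : ℂ) + v * I) * cexp ((((3 / 4 : ℝ) : ℂ) + v * I) ^ 2) *
        (((1 : ℝ) : ℂ)) ^ (-(((3 / 4 : ℝ) : ℂ) + v * I)) / (((3 / 4 : ℝ) : ℂ) + v * I) := by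
  rw [← integral_comp_neg' (fun v : ℝ => (fun w : ℂ => (q : ℂ) ^ ((s + w) / 2) *
      completedLFunction χ (s + w))
        (((-(3 / 4) : ℝ) : ℂ) + v * I) * cexp ((((-(3 / 4) : ℝ) : ℂ) + v * I) ^ 2) *
        (((1 : ℝ) : ℂ)) ^ (-(((-(3 / 4) : ℝ) : ℂ) + v * I)) / (((-(3 / 4) : ℝ) : ℂ) + v * I)),
    ← integral_const_mul]
  refine integral_congr_ae (Eventually.of_forall fun v => ?_)
  simp only
  -- `u' = 3/4 + iv`, `−3/4 + i(−v) = −u'`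
  set u : ℂ := ((3 / 4 : ℝ) : ℂ) + v * I with hu
  have hneg : (((-(3 / 4) : ℝ) : ℂ) + ((-v : ℝ) : ℂ) * I) = -u := by
    rw [hu]; push_cast; ring
  rw [hneg]
  have hrefl := LambdaTilde_reflect hχ s u
  rw [show s + -u = s - u by ring, hrefl, neg_sq, Complex.ofReal_one, one_cpow, one_cpow]
  have hu0 : u ≠ 0 := by
    intro h; have := congrArg Complex.re h; simp [hu] at this
  field_simp

/-- **THE CONTOUR IDENTITY OF THE SMOOTH APPROXIMATE FUNCTIONAL EQUATION**: for `χ` primitive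
mod `q > 1` and `Re s = ½`,
`2π Λ̃(χ,s) = I(χ,s) + ε(χ) I(χ̄, 1−s)`, `I(ψ,z) = ∫ Λ̃(ψ, z+u) e^{u²} u^{-1} dv` (`u = ¾ + iv`).
[cite: IwaniecKowalski2004, Theorem 5.3] -/
theorem afe_contour_identity (hq : 1 < q) {χ : DirichletCharacter ℂ q} (hχ : χ.IsPrimitive)
    {s : ℂ} (hs : s.re = 1 / 2) :
    2 * π * ((q : ℂ) ^ (s / 2) * completedLFunction χ s) =
      (∫ v : ℝ, (fun w : ℂ => (q : ℂ) ^ ((s + w) / 2) * completedLFunction χ (s + w))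
        (((3 / 4 : ℝ) : ℂ) + v * I) * cexp ((((3 / 4 : ℝ) : ℂ) + v * I) ^ 2) *
        (((1 : ℝ) : ℂ)) ^ (-(((3 / 4 : ℝ) : ℂ) + v * I)) / (((3 / 4 : ℝ) : ℂ) + v * I)) +
      rootNumber χ * ∫ v : ℝ, (fun w : ℂ => (q : ℂ) ^ ((1 - s + w) / 2) *
        completedLFunction χ⁻¹ (1 - s + w))
        (((3 / 4 : ℝ) : ℂ) + v * I) * cexp ((((3 / 4 : ℝ) : ℂ) + v * I) ^ 2) *
        (((1 : ℝ) : ℂ)) ^ (-(((3 / 4 : ℝ) : ℂ) + v * I)) / (((3 / 4 : ℝ) : ℂ) + v * I) := by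
  have h1 := integral_LambdaTilde_shift hq hχ hs
  have h2 := integral_LambdaTilde_left_eq hχ s
  rw [h2] at h1
  linear_combination -h1

end Literature.NumberTheory.LFunctions.DirichletConvexity

end
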